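import Literature.Probability.Percolation.CerfUniquenessZoneBound
import Literature.Probability.Percolation.CriticalContinuityProofs
import Literature.Barriers.CriticalPhenomena.KozmaNachmiasLemma31
import HarnessLib

/-!
# Crux `PercShatteringRace.NearLinearTwoClusterDecay` (stmt-CriticalPhenomena-5785) — frontier stub W1 `stub_critPairConnLower`

Helper file of the line `pair-decay-long-arms-dense` (lead c6); lands with `--supports stmt-CriticalPhenomena-5785`
(registered stub `stub_critPairConnLower` of skeleton rev L7-c6, § Unconditional frontier).

## Statement

`stub_critPairConnLower`: there is `c > 0` such that for every `n ≥ 1` and all `a, b ∈ Λ_n`,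
`P_{p_c(ℤ³)}(a ↔ b inside Λ_{2n}) ≥ c n^{-12}` — an UNCONDITIONAL (no assumption on `θ(p_c)`)
polynomial lower bound on pair connections inside boxes for bond percolation on `ℤ³` at `p = p_c`,
the input of Cerf's Lemma 7.1 / Corollary 7.2 in the world-free layer of the line.

## Proof sketch

* Duminil-Copin–Tassion's finite-size criterion at criticality, `φ_{p_c}(Λ_m) ≥ 1`, in the
  Kozma–Nachmias form already in the tree: `Σ_{z ∈ ∂Λ_m} P_{p_c}(0 ↔ z in Λ_m) ≥ 1/(2d) = 1/6`
  (`Literature.Barriers.CriticalPhenomena.sum_sphere_real_openConnIn_ge`, from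
  `one_le_phi_criticalProbI` and `φ_p(Λ_m) ≤ 2d Σ_{z ∈ ∂Λ_m} P_p(0 ↔ z in Λ_m)`).
* Pigeonhole over `∂Λ_m = ∂ⁱⁿΛ_m` (`sphere_eq_innerBoundary`), `|∂ⁱⁿΛ_m| ≤ 2·3·(2m+1)²`
  (`card_innerBoundary_box_le`): some `b_m ∈ ∂ⁱⁿΛ_m` has
  `P_{p_c}(0 ↔ b_m in Λ_m) ≥ (1/6)/(6(2m+1)²)` (`exists_boundary_point_critical`), i.e. the
  point-to-boundary input of the tree's bond two-point bound with `κ = 1/6`.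
* Cerf 2015 Lemma 6.1 chaining (Harris–FKG + reflections), bond version
  `AKN.bconn_two_point_lower`: for `a, b ∈ Λ_n`,
  `P_{p_c}(a ↔ b in Λ_{2n}) ≥ p_c^5 (p_c ((1/6)/(6(2n+1)²))²)³ = p_c^8 / (36^6 (2n+1)^{12})`.
* `bconn Λ x y = openConnVia (withinGraph ℤ³ Λ) x y` and `openConnIn ↑Λ x y` agree on configurations of
  lattice edges, hence in probability (`real_openConnIn_eq_real_bconn`, via
  `openConnIn_eq_openConnVia`, `openClusterIn_withinGraph_eq_top`,
  `DCT16.real_congr_of_forall_subset_edgeSet`).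
* Arithmetic: `(2n+1) ≤ 3n` for `n ≥ 1`, so the bound is `≥ c n^{-12}` with
  `c = p_c^8/(36^6 3^{12}) > 0` (`0 < p_c(ℤ³)`, Grimmett 1999 Thm (1.10),
  `Grimmett1999_criticalProb_pos_lt_one_holds`).

## References

* H. Duminil-Copin, V. Tassion, *A new proof of the sharpness of the phase transition for Bernoulli
  percolation and the Ising model*, Enseign. Math. 62 (2016) 199–206, §1 and Thm 1.1
  [DuminilCopinTassionEM2016].
* G. Kozma, A. Nachmias, *Arm exponents in high dimensional percolation*, J. Amer. Math. Soc. 24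
  (2011) 375–409, Lemma 3.1 [KozmaNachmias2011].
* R. Cerf, *A lower bound on the two-arms exponent for critical percolation on the lattice*,
  Ann. Probab. 43 (2015) 2458–2480, Lemma 6.1 (arXiv:1306.3105) [Cerf2015].
* H. Duminil-Copin, G. Kozma, V. Tassion, *Upper bounds on the percolation correlation length*,
  arXiv:1902.03207, §7 (39)–(40) [DuminilcopinKozmaTassion2020].
* G. Grimmett, *Percolation*, 2nd ed., Springer 1999, §1.4 Theorem (1.10) [Grimmett1999].
-/

noncomputable section

namespace Summit.CriticalPhenomena.PercolationContinuityZ3.Theorems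

namespace NearLinearTwoClusterDecayCritPairConn

open MeasureTheory Filter Topology
open Literature.Probability.LatticeModels Literature.Probability.Percolation

/-- **`openConnIn` versus `bconn`**: for `x ∈ S`, the tree's event `openConnIn ↑S x y` ("`x ↔ y` by an
open path inside `S`", any pairs) and Cerf's `AKN.bconn S x y = openConnVia (withinGraph ℤ^d S) x y`
(lattice edges inside `S`) agree on configurations of lattice edges, hence have the same
`P_p`-probability. [folklore] -/
theorem real_openConnIn_eq_real_bconn {d : ℕ} (p : unitInterval) {S : Finset (Site d)} {x : Site d}
    (hx : x ∈ S) (y : Site d) :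
    (bondPercolation (zdGraph d) p).real (openConnIn (↑S : Set (Site d)) x y) =
      (bondPercolation (zdGraph d) p).real (AKN.bconn S x y) := by
  refine DCT16.real_congr_of_forall_subset_edgeSet (zdGraph d) p fun ω hω => ?_
  rw [openConnIn_eq_openConnVia (Finset.mem_coe.2 hx)]
  simp only [AKN.bconn, openConnVia, Set.mem_setOf_eq]
  rw [openClusterIn_withinGraph_eq_top (zdGraph d) _ hω]

/-- **Point-to-boundary input at `p_c(ℤ³)`** (pigeonhole on Kozma–Nachmias Lemma 3.1 /
Duminil-Copin–Tassion `φ_{p_c}(Λ_m) ≥ 1`): some `b ∈ ∂ⁱⁿΛ_m` has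
`P_{p_c}(0 ↔ b in Λ_m) ≥ 1/(36 (2m+1)²) ≤ (1/6)/|∂ⁱⁿΛ_m|`.
[cite: KozmaNachmias2011, Lemma 3.1] -/
theorem exists_boundary_point_critical (m : ℕ) :
    ∃ b ∈ innerBoundary (zdGraph 3) (box 3 m),
      1 / (36 * (2 * (m : ℝ) + 1) ^ 2) ≤
        (bondPercolation (zdGraph 3) (criticalProbI 3)).real (AKN.bconn (box 3 m) 0 b) := by
  set μ := bondPercolation (zdGraph 3) (criticalProbI 3) with hμ
  -- Kozma–Nachmias / Duminil-Copin–Tassion: `1/(2·3) ≤ Σ_{z ∈ ∂Λ_m} P_{p_c}(0 ↔ z in Λ_m)`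
  have hsum : 1 / (2 * ((3 : ℕ) : ℝ)) ≤ ∑ z ∈ Literature.Probability.LatticeModels.sphere 3 m,
      μ.real (openConnIn (↑(box 3 m) : Set (Site 3)) 0 z) :=
    Literature.Barriers.CriticalPhenomena.sum_sphere_real_openConnIn_ge (d := 3) (by norm_num)
      (criticalProbI 3) (coe_criticalProbI 3).symm.le m
  -- the same with `bconn`, over the inner boundary
  have hsum' : (1 : ℝ) / 6 ≤ ∑ z ∈ innerBoundary (zdGraph 3) (box 3 m), μ.real (AKN.bconn (box 3 m) 0 z) := by
    have h6 : (1 : ℝ) / 6 = 1 / (2 * ((3 : ℕ) : ℝ)) := by norm_num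
    rw [h6, ← sphere_eq_innerBoundary (by norm_num : 1 ≤ 3)]
    refine hsum.trans (le_of_eq (Finset.sum_congr rfl fun z _ => ?_))
    exact real_openConnIn_eq_real_bconn _ (zero_mem_box 3 m) z
  -- `|∂ⁱⁿΛ_m| ≤ 6 (2m+1)²`
  have hcard : ((innerBoundary (zdGraph 3) (box 3 m)).card : ℝ) ≤ 6 * (2 * (m : ℝ) + 1) ^ 2 := by
    have h := card_innerBoundary_box_le (d := 3) m
    have h' : ((innerBoundary (zdGraph 3) (box 3 m)).card : ℝ) ≤ ((2 * 3 * (2 * m + 1) ^ (3 - 1) : ℕ) : ℝ) := by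
      exact_mod_cast h
    refine h'.trans (le_of_eq ?_)
    push_cast
    ring
  -- pigeonhole
  by_contra hcon
  push Not at hcon
  have hne : (innerBoundary (zdGraph 3) (box 3 m)).Nonempty := by
    by_contra h
    rw [Finset.not_nonempty_iff_eq_empty] at h
    rw [h, Finset.sum_empty] at hsum'
    norm_num at hsum'
  have hlt : ∑ z ∈ innerBoundary (zdGraph 3) (box 3 m), μ.real (AKN.bconn (box 3 m) 0 z) <
      ∑ _z ∈ innerBoundary (zdGraph 3) (box 3 m), 1 / (36 * (2 * (m : ℝ) + 1) ^ 2) :=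
    Finset.sum_lt_sum_of_nonempty hne fun b hb => hcon b hb
  rw [Finset.sum_const, nsmul_eq_mul] at hlt
  have hle : ((innerBoundary (zdGraph 3) (box 3 m)).card : ℝ) * (1 / (36 * (2 * (m : ℝ) + 1) ^ 2)) ≤ 1 / 6 := by
    rw [mul_one_div, div_le_div_iff₀ (by positivity) (by norm_num)]
    linarith
  linarith

/-- **The arithmetic**: for `n ≥ 1` and `p ≥ 0`,
`p^8/(36^6 3^{12}) · n^{-12} ≤ p^5 (p ((1/6)/(2·3·(2n+1)²))²)³ = p^8/(36^6 (2n+1)^{12})`,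
since `2n+1 ≤ 3n`. [folklore] -/
theorem const_mul_rpow_le_two_point (p : ℝ) (hp : 0 ≤ p) {n : ℕ} (hn : 1 ≤ n) :
    p ^ 8 / (36 ^ 6 * 3 ^ 12) * (n : ℝ) ^ (-(12 : ℝ)) ≤
      p ^ (3 + 2) * (p * (1 / 6 / (2 * ((3 : ℕ) : ℝ) * (2 * n + 1) ^ (3 - 1))) ^ 2) ^ 3 := by
  have hn1 : (1 : ℝ) ≤ n := by exact_mod_cast hn
  have hn0 : (0 : ℝ) < n := by linarith
  have hrpow : (n : ℝ) ^ (-(12 : ℝ)) = ((n : ℝ) ^ 12)⁻¹ := by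
    rw [Real.rpow_neg hn0.le, show (12 : ℝ) = ((12 : ℕ) : ℝ) by norm_num, Real.rpow_natCast]
  have hrhs : p ^ (3 + 2) * (p * (1 / 6 / (2 * ((3 : ℕ) : ℝ) * (2 * n + 1) ^ (3 - 1))) ^ 2) ^ 3 =
      p ^ 8 / (36 ^ 6 * (2 * (n : ℝ) + 1) ^ 12) := by
    have h : (2 * (n : ℝ) + 1) ≠ 0 := by positivity
    simp only [Nat.cast_ofNat, Nat.reduceAdd, Nat.reduceSub]
    field_simp
    ring
  rw [hrpow, hrhs, ← div_eq_mul_inv, div_div]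
  refine div_le_div_of_nonneg_left (pow_nonneg hp 8) (by positivity) ?_
  have h3 : (2 * (n : ℝ) + 1) ^ 12 ≤ (3 * (n : ℝ)) ^ 12 :=
    pow_le_pow_left₀ (by positivity) (by linarith) 12
  calc (36 : ℝ) ^ 6 * (2 * (n : ℝ) + 1) ^ 12 ≤ 36 ^ 6 * (3 * (n : ℝ)) ^ 12 := by gcongr
    _ = 36 ^ 6 * 3 ^ 12 * (n : ℝ) ^ 12 := by ring

end NearLinearTwoClusterDecayCritPairConn

open MeasureTheory Filter Topology
open Literature.Probability.LatticeModels Literature.Probability.Percolation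
open NearLinearTwoClusterDecayCritPairConn

/-- **Frontier stub W1 `stub_critPairConnLower` of the line `pair-decay-long-arms-dense`** (registered):
the UNCONDITIONAL two-point lower bound inside boxes at `p_c(ℤ³)` — there is `c > 0` with
`P_{p_c}(a ↔ b inside Λ_{2n}) ≥ c n^{-12}` for all `n ≥ 1`, `a, b ∈ Λ_n` (Duminil-Copin–Tassion
`φ_{p_c}(Λ_m) ≥ 1` ⇒ point-to-boundary input `κ = 1/6` ⇒ Cerf 2015 Lemma 6.1 chaining
`AKN.bconn_two_point_lower`, with `c = p_c^8/(36^6 3^{12})`).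
[cite: Cerf2015, Lem 6.1] [cite: DuminilcopinKozmaTassion2020, §7 (39)-(40)] -/
theorem stub_critPairConnLower :
    ∃ c : ℝ, 0 < c ∧ ∀ n : ℕ, 1 ≤ n → ∀ a ∈ box 3 n, ∀ b ∈ box 3 n,
      c * (n : ℝ) ^ (-(12 : ℝ)) ≤
        (bondPercolation (zdGraph 3) (criticalProbI 3)).real (openConnIn (↑(box 3 (2 * n)) : Set (Site 3)) a b) := by
  have hpc0 : 0 < ((criticalProbI 3 : unitInterval) : ℝ) := by
    rw [coe_criticalProbI]
    exact (Grimmett1999_criticalProb_pos_lt_one_holds 3 (by norm_num)).1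
  refine ⟨((criticalProbI 3 : unitInterval) : ℝ) ^ 8 / (36 ^ 6 * 3 ^ 12), by positivity,
    fun n hn a ha b hb => ?_⟩
  -- the point-to-boundary input of the two-point bound, `κ = 1/6`, at every scale `m ≥ 1`
  have hinput : ∀ m : ℕ, 1 ≤ m → m ≤ n → ∃ b ∈ innerBoundary (zdGraph 3) (box 3 m),
      (1 / 6 : ℝ) / (2 * ((3 : ℕ) : ℝ) * (2 * m + 1) ^ (3 - 1)) ≤
        (bondPercolation (zdGraph 3) (criticalProbI 3)).real (AKN.bconn (box 3 m) 0 b) := by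
    intro m _ _
    obtain ⟨z, hz, h⟩ := exists_boundary_point_critical m
    refine ⟨z, hz, le_trans (le_of_eq ?_) h⟩
    simp only [Nat.cast_ofNat, Nat.reduceSub]
    rw [div_div]
    ring
  -- Cerf's Lemma 6.1 chaining (bond version)
  have key := AKN.bconn_two_point_lower (d := 3) (criticalProbI 3) (κ := 1 / 6) (by norm_num) (by norm_num)
    hinput ha hb
  -- `bconn (box 3 (2n)) a b` has the probability of `openConnIn ↑(box 3 (2n)) a b`
  have ha2 : a ∈ box 3 (2 * n) := box_mono 3 (Nat.le_mul_of_pos_left n two_pos) ha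
  rw [← real_openConnIn_eq_real_bconn (criticalProbI 3) ha2 b] at key
  exact (const_mul_rpow_le_two_point _ hpc0.le hn).trans key

end Summit.CriticalPhenomena.PercolationContinuityZ3.Theorems
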